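import Mathlib
import Summits.CriticalPhenomena.CardyFormulaZ2.Theorems.CardyMagicRigidityNestingRigidityBondLoopTraversalData
import Literature.Topology.PlaneTopology.AnnulusArcs
import HarnessLib

/-!
# (H1) for bond-`ℤ²` interface loops, brick 4: many traversals force many disjoint open crossings

Crux `Summit.CriticalPhenomena.CardyFormulaZ2.Theses.CardyMagicRigidity.NestingRigidity`
(stmt-CriticalPhenomena-4835), line `positive-cone-weight-doubling`, stub `bond_loop_traversalBound`.
The deterministic core of Aizenman–Burchard 1999, Appendix A, for the system of interface LOOPS of bond
percolation on `δℤ²` (`BondLoopH1.mem_disjointOccurrencePow_of_hasTraversals`): if the rounded Jordan loop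
`Λ` of the orbit of a periodic corner of `β` traverses `D(x; ρ, R)` `2j + 3` times and `0 < q₁`, `ρ ≤ q₁`,
`q₁ + 40δ ≤ q₂ ≤ R`, then the lattice configuration `β ∩ E(ℤ²)` contains `j` pairwise vertex-disjoint open
crossings of `A(x; q₁ + 11δ, q₂ - 11δ)`, i.e. lies in `(annulusOpenCrossing x δ (q₁ + 11δ) (q₂ - 11δ))^{□ j}`.
The argument is that of the tree's site-`𝕋` version (`LoopTraversalBound.lean`,
`IsSiteInterfaceLoop.mem_disjointOccurrencePow_of_hasTraversals`): the first `2j + 2` traversals happen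
before time `1`, where `Λ` is injective, so their strict crossings (brick 3) are pairwise disjoint arcs
across the closed shell; the component of the primal vertex of the middle dart of each touches its arc
inside the open shell, hence by the three-arcs lemma `not_three_arcs_touch` (`AnnulusArcs.lean`, winding
numbers) no three of these components coincide, at least `j + 1` are distinct, and the open primal chains of
`j` of them (brick 3) are pairwise vertex-disjoint (`mem_disjointOccurrencePow_annulusOpenCrossing_of_chains`).
Registered anchor: `bondLoopH1_disjoint_crossings_of_traversals`.
-/

noncomputable section

open MeasureTheory Set Filter Metric TopologicalSpace Function
open scoped Topology ENNReal NNReal unitInterval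

namespace Summit.CriticalPhenomena.CardyFormulaZ2.Cruxes.NestingRigidity.PositiveConeWeightDoubling

open Literature.Probability.RandomPlanarGeometry Literature.Probability.Percolation
  Literature.Probability.LatticeModels Literature.Topology.PlaneTopology

/-! Local notations (no definitions are introduced): the rounded Jordan loop of the orbit of the corner `p`
of `β` at mesh `δ`, read on `[0, 1]`, and the index `⌊Q t⌋` of the current dart at time `t`. -/
local notation3 "RC[" β ", " p ", " δ "]" =>
  (Curve.ofPeriodic (OrbitPolygon.loop β p δ) OrbitPolygon.continuous_loop : Curve ℂ)
local notation3 "uIdx[" Q ", " t "]" => ⌊(Q : ℝ) * ((t : unitInterval) : ℝ)⌋₊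

namespace BondLoopH1

variable {β : BondConfig (Site 2)} {p : Site 2 × Fin 4} {δ : ℝ}

/-- **Many traversals of a shell by the rounded loop force many disjoint open crossings** (see the
module docstring). [cite: AizenmanBurchardDuke1999, Appendix A] -/
theorem mem_disjointOccurrencePow_of_hasTraversals (hp : p ∈ periodicPts (nextCorner β)) (hδ : 0 < δ)
    {x : ℂ} {ρ R q₁ q₂ : ℝ} (hq₁ : 0 < q₁) (hρq : ρ ≤ q₁) (hgap : q₁ + 40 * δ ≤ q₂) (hqR : q₂ ≤ R)
    {j : ℕ} (htr : RC[β, p, δ].HasTraversals (2 * j + 3) x ρ R) :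
    β ∩ (zdGraph 2).edgeSet ∈
      disjointOccurrencePow (annulusOpenCrossing x δ (q₁ + 11 * δ) (q₂ - 11 * δ)) j := by
  classical
  set Λ := RC[β, p, δ] with hΛ
  set U : Set ℂ := {z | q₁ < dist z x ∧ dist z x < q₂} with hU
  have hq : q₁ < q₂ := by linarith
  obtain ⟨s, t, htrav, hsep⟩ := htr.of_le (show 2 * j + 2 + 1 ≤ 2 * j + 3 by omega)
  -- the first `2j + 2` traversals happen before time `1`
  have ht1 : ∀ l : Fin (2 * j + 2), ((t (Fin.castSucc l) : I) : ℝ) < 1 := fun l ↦ by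
    have h1 : t (Fin.castSucc l) < s (Fin.last _) := hsep (Fin.castSucc_lt_last l)
    exact lt_of_lt_of_le (show ((t (Fin.castSucc l) : I) : ℝ) < s (Fin.last _) from h1) (s (Fin.last _)).2.2
  choose a b dir m k₀ k₁ z hsa hab hbt hA hB hstrict hzarc hzU hzcl hk₀k₁ hcomp hends using
    fun l : Fin (2 * j + 2) ↦ exists_traversal_data hp hδ hρq hgap hqR (htrav (Fin.castSucc l))
  have htimes : ∀ l (v : I), a l ≤ v → v ≤ b l → (v : ℝ) < 1 := fun l v _ hvb ↦
    lt_of_le_of_lt (show (v : ℝ) ≤ t (Fin.castSucc l) from hvb.trans (hbt l)) (ht1 l)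
  /- the components of the primal vertices of the middle darts -/
  set comp : Fin (2 * j + 2) → Set ℂ := fun l ↦
    connectedComponentIn (U \ range (OrbitPolygon.loop β p δ)) (meshPoint δ (OrbitPolygon.cv β p (m l)))
    with hcompdef
  /- the arcs -/
  set arc : ∀ _ : Fin (2 * j + 2), Σ q : ℂ × ℂ, Path q.1 q.2 :=
    fun l ↦ orientedArc Λ (a l) (b l) (hab l).le (dir l) with harc
  have harc1 : ∀ l, (arc l).1 = if dir l then (Λ (a l), Λ (b l)) else (Λ (b l), Λ (a l)) :=
    fun l ↦ orientedArc_fst Λ (hab l).le (dir l)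
  have hrange : ∀ l, range (arc l).2 = Λ '' {v | a l ≤ v ∧ v ≤ b l} :=
    fun l ↦ range_orientedArc Λ (hab l).le (dir l)
  -- points of an arc: distances, and the only points on the circles
  have hpt : ∀ l (v : I), a l ≤ v → v ≤ b l →
      (dist (Λ v) x = q₁ → Λ v = (arc l).1.1) ∧ (dist (Λ v) x = q₂ → Λ v = (arc l).1.2) ∧
      q₁ ≤ dist (Λ v) x ∧ dist (Λ v) x ≤ q₂ := by
    intro l v hav hvb
    have h1 := hA l; have h2 := hB l; have h3 := harc1 l
    cases hd : dir l
    · -- `dir = false`: `Λ a` on the outer circle, `Λ b` on the inner one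
      simp only [hd, Bool.false_eq_true, ↓reduceIte] at h1 h2 h3
      rw [h3]
      rcases eq_or_lt_of_le hav with h | h
      · subst h; exact ⟨fun h' ↦ by rw [h1] at h'; linarith, fun _ ↦ rfl, by rw [h1]; exact hq.le, by rw [h1]⟩
      rcases eq_or_lt_of_le hvb with h' | h'
      · subst h'; exact ⟨fun _ ↦ rfl, fun h'' ↦ by rw [h2] at h''; linarith, by rw [h2], by rw [h2]; exact hq.le⟩
      have := hstrict l v h h'
      exact ⟨fun h'' ↦ by linarith [this.1], fun h'' ↦ by linarith [this.2], this.1.le, this.2.le⟩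
    · -- `dir = true`: `Λ a` on the inner circle, `Λ b` on the outer one
      simp only [hd, ↓reduceIte] at h1 h2 h3
      rw [h3]
      rcases eq_or_lt_of_le hav with h | h
      · subst h; exact ⟨fun _ ↦ rfl, fun h' ↦ by rw [h1] at h'; linarith, by rw [h1], by rw [h1]; exact hq.le⟩
      rcases eq_or_lt_of_le hvb with h' | h'
      · subst h'; exact ⟨fun h'' ↦ by rw [h2] at h''; linarith, fun _ ↦ rfl, by rw [h2]; exact hq.le, by rw [h2]⟩
      have := hstrict l v h h'
      exact ⟨fun h'' ↦ by linarith [this.1], fun h'' ↦ by linarith [this.2], this.1.le, this.2.le⟩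
  have he : ∀ l, dist (arc l).1.1 x = q₁ := by
    intro l; have h1 := hA l; have h2 := hB l; rw [harc1]
    cases hd : dir l
    · simp only [hd, Bool.false_eq_true, ↓reduceIte] at h1 h2 ⊢; exact h2
    · simp only [hd, ↓reduceIte] at h1 h2 ⊢; exact h1
  have hf : ∀ l, dist (arc l).1.2 x = q₂ := by
    intro l; have h1 := hA l; have h2 := hB l; rw [harc1]
    cases hd : dir l
    · simp only [hd, Bool.false_eq_true, ↓reduceIte] at h1 h2 ⊢; exact h1
    · simp only [hd, ↓reduceIte] at h1 h2 ⊢; exact h2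
  have hmemarc : ∀ l (u : I), ∃ v : I, a l ≤ v ∧ v ≤ b l ∧ (arc l).2 u = Λ v := by
    intro l u
    have : (arc l).2 u ∈ range (arc l).2 := ⟨u, rfl⟩
    rw [hrange] at this
    obtain ⟨v, ⟨h1, h2⟩, h3⟩ := this
    exact ⟨v, h1, h2, h3.symm⟩
  -- the arcs are pairwise disjoint (the rounded loop is simple before time `1`)
  have hinj := roundedCurve_injOn hp hδ
  have hdisj : ∀ l l', l ≠ l' → Disjoint (range (arc l).2) (range (arc l').2) := by
    intro l l' hll'
    rw [hrange, hrange]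
    refine disjoint_left.2 ?_
    rintro w ⟨v, ⟨hv1, hv2⟩, rfl⟩ ⟨v', ⟨hv1', hv2'⟩, hvv'⟩
    have heq : v = v' := hinj (htimes l v hv1 hv2) (htimes l' v' hv1' hv2') hvv'.symm
    subst heq
    rcases lt_or_gt_of_ne hll' with h | h
    · have h1 : t (Fin.castSucc l) < s (Fin.castSucc l') := hsep (Fin.castSucc_lt_castSucc_iff.2 h)
      exact lt_irrefl _ (lt_of_le_of_lt (hv2.trans (hbt l)) (h1.trans_le ((hsa l').trans hv1')))
    · have h1 : t (Fin.castSucc l') < s (Fin.castSucc l) := hsep (Fin.castSucc_lt_castSucc_iff.2 h)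
      exact lt_irrefl _ (lt_of_le_of_lt (hv2'.trans (hbt l')) (h1.trans_le ((hsa l).trans hv1)))
  -- the components miss the arcs
  have hcompsub : ∀ l, comp l ⊆ U \ range (OrbitPolygon.loop β p δ) := fun l ↦ connectedComponentIn_subset _ _
  have hST : ∀ l l', Disjoint (comp l) (range (arc l').2) := by
    intro l l'
    rw [hrange]
    refine disjoint_left.2 ?_
    rintro w hw ⟨v, -, rfl⟩
    exact (hcompsub l hw).2 ⟨(v : ℝ), rfl⟩
  /- no three components coincide -/
  have hfib : ∀ l₁ l₂ l₃ : Fin (2 * j + 2), l₁ ≠ l₂ → l₂ ≠ l₃ → l₃ ≠ l₁ →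
      comp l₁ = comp l₂ → comp l₂ = comp l₃ → False := by
    intro l₁ l₂ l₃ h12 h23 h31 e12 e23
    have htouch : ∀ l, comp l₁ = comp l → (closure (comp l₁) ∩ range (arc l).2 ∩ U).Nonempty := by
      intro l e
      refine ⟨z l, ⟨?_, ?_⟩, hzU l⟩
      · rw [e]; exact hzcl l
      · rw [hrange]; exact hzarc l
    exact not_three_arcs_touch hq₁ hq (fun l ↦ (arc l).2) he hf
      (fun l u ↦ by obtain ⟨v, h1, h2, h3⟩ := hmemarc l u; rw [h3]; exact ⟨(hpt l v h1 h2).2.2.1, (hpt l v h1 h2).2.2.2⟩)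
      (fun l u hu ↦ by obtain ⟨v, h1, h2, h3⟩ := hmemarc l u; rw [h3] at hu ⊢; exact (hpt l v h1 h2).1 hu)
      (fun l u hu ↦ by obtain ⟨v, h1, h2, h3⟩ := hmemarc l u; rw [h3] at hu ⊢; exact (hpt l v h1 h2).2.1 hu)
      hdisj isPreconnected_connectedComponentIn (fun w hw ↦ (hcompsub l₁ hw).1) (hST l₁) h12 h23 h31
      (htouch l₁ rfl) (htouch l₂ e12) (htouch l₃ (e12.trans e23))
  /- counting: at least `j + 1` distinct components -/
  set F : Finset (Set ℂ) := Finset.univ.image comp with hF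
  have hcard : 2 * j + 2 ≤ 2 * F.card := by
    have h := Finset.card_le_mul_card_image (Finset.univ : Finset (Fin (2 * j + 2))) (f := comp) 2 ?_
    · simpa using h
    intro y hy
    by_contra hgt
    push Not at hgt
    obtain ⟨l₁, hl₁, l₂, hl₂, l₃, hl₃, h12, h13, h23⟩ := exists_three_of_two_lt_card hgt
    simp only [Finset.mem_filter, Finset.mem_univ, true_and] at hl₁ hl₂ hl₃
    exact hfib l₁ l₂ l₃ h12 h23 (Ne.symm h13) (hl₁.trans hl₂.symm) (hl₂.trans hl₃.symm)
  have hjF : j ≤ F.card := by omega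
  -- a section of `comp` over `F`, and `j` indices with pairwise distinct components
  have hsec : ∀ y : F, ∃ l, comp l = y := fun y ↦ by
    obtain ⟨l, -, hl⟩ := Finset.mem_image.1 y.2
    exact ⟨l, hl⟩
  choose sec hsec using hsec
  set L : Fin j → Fin (2 * j + 2) := fun i ↦ sec (F.equivFin.symm (Fin.castLE hjF i)) with hL
  have hLne : ∀ i i', i ≠ i' → comp (L i) ≠ comp (L i') := by
    intro i i' hii' h
    apply hii'
    have h1 : (F.equivFin.symm (Fin.castLE hjF i) : Set ℂ) = F.equivFin.symm (Fin.castLE hjF i') := by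
      rw [← hsec, ← hsec]; exact h
    have h2 := F.equivFin.symm.injective (Subtype.ext h1)
    exact Fin.castLE_injective hjF h2
  /- the chains -/
  refine mem_disjointOccurrencePow_annulusOpenCrossing_of_chains (ω := β ∩ (zdGraph 2).edgeSet) hδ.le
    (x := x) (r' := q₁ + 11 * δ) (R' := q₂ - 11 * δ) (by linarith)
    (fun v w h ↦ by rw [dist_meshPoint_of_adj ((SimpleGraph.mem_edgeSet _).1 h.2), abs_of_pos hδ])
    (j := j) (N := fun i ↦ k₁ (L i) - k₀ (L i)) (fun i q ↦ OrbitPolygon.cv β p (k₀ (L i) + q))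
    (fun i q hq' ↦ ?_) (fun i ↦ ?_) (fun i i' hii' q q' heq ↦ ?_)
  · -- consecutive vertices equal or joined by an open lattice edge
    rcases cv_succ_eq_or_mem (β := β) (p := p) (k₀ (L i) + q) with h | h
    · exact Or.inl h
    · exact Or.inr h
  · -- ends
    have e : k₀ (L i) + (k₁ (L i) - k₀ (L i)) = k₁ (L i) := by have := hk₀k₁ (L i); omega
    simp only [Fin.val_zero, add_zero, Fin.val_last]
    rw [e]
    exact hends (L i)
  · -- disjointness from distinct components
    apply hLne i i' hii'
    have h1 := hcomp (L i) (k₀ (L i) + q) (Nat.le_add_right _ _) (by have := q.2; have := hk₀k₁ (L i); omega)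
    have h2 := hcomp (L i') (k₀ (L i') + q') (Nat.le_add_right _ _)
      (by have := q'.2; have := hk₀k₁ (L i'); omega)
    rw [heq] at h1
    change connectedComponentIn _ (meshPoint δ (OrbitPolygon.cv β p (m (L i)))) =
      connectedComponentIn _ (meshPoint δ (OrbitPolygon.cv β p (m (L i'))))
    rw [connectedComponentIn_eq h1, connectedComponentIn_eq h2]

end BondLoopH1

/-- **Registered anchor** (`bondLoopH1_disjoint_crossings_of_traversals`): `2j + 3` traversals of
`D(x; ρ, R)` by the rounded Jordan loop of the orbit of a periodic corner of `β` (`0 < q₁`, `ρ ≤ q₁`,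
`q₁ + 40δ ≤ q₂ ≤ R`) put `β ∩ E(ℤ²)` in the `j`-fold disjoint occurrence of the open crossing of
`A(x; q₁ + 11δ, q₂ - 11δ)`. [cite: AizenmanBurchardDuke1999, Appendix A] -/
theorem bondLoopH1_disjoint_crossings_of_traversals : ∀ (β : BondConfig (Site 2)) (p : Site 2 × Fin 4),
    p ∈ periodicPts (nextCorner β) → ∀ (δ : ℝ), 0 < δ → ∀ (x : ℂ) (ρ R q₁ q₂ : ℝ), 0 < q₁ → ρ ≤ q₁ →
    q₁ + 40 * δ ≤ q₂ → q₂ ≤ R → ∀ (j : ℕ),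
    (Curve.ofPeriodic (OrbitPolygon.loop β p δ) OrbitPolygon.continuous_loop).HasTraversals (2 * j + 3) x ρ R →
    β ∩ (zdGraph 2).edgeSet ∈
      disjointOccurrencePow (annulusOpenCrossing x δ (q₁ + 11 * δ) (q₂ - 11 * δ)) j :=
  fun _ _ hp _ hδ _ _ _ _ _ hq₁ hρq hgap hqR _ htr ↦
    BondLoopH1.mem_disjointOccurrencePow_of_hasTraversals hp hδ hq₁ hρq hgap hqR htr

end Summit.CriticalPhenomena.CardyFormulaZ2.Cruxes.NestingRigidity.PositiveConeWeightDoubling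

end
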